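import Summits.CriticalPhenomena.SAWScalingLimit.Theorems.SAWMassiveIsingTiltHexEndpointApproxExistsBulk
import Literature.Probability.RandomPlanarGeometry.SAWScalingLimitFamily
import Literature.Probability.RandomPlanarGeometry.ChordalCurveFamily
import Summits.CriticalPhenomena.SAWScalingLimit.Theses.SAWMassiveIsingTilt
import Mathlib.Data.Set.Card
import HarnessLib

/-!
# Item `stmt-CriticalPhenomena-9864`: honeycomb endpoint approximations exist (`HexEndpointApproxExists`)

Route `SAWMassiveIsingTilt` (also `SAWResidueField`), sub-problem `SAWScalingLimit`. Main file of
three (`…Stray`, `…Bulk`, this one).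

* Dictionary (`HexMeshCoord.lean`): the honeycomb mesh vertex graph
  `embMeshVertexGraph hexGraph hexCenter Ω δ` is isomorphic, along the attachment `v ↦ φ v`, to
  `G_N` of the scaled domain `{z | R z ∈ Ω}`, `R = (1 + ζ)/3` (`mem_embMeshVertices_iff_hexSite`,
  `embMeshGraph_adj_iff_hexSite`; `hexCenter v = R · triEmbed (φ v)`).
* `exists_forall_mem_hexMeshDomain_and_reachable` — **the largest honeycomb mesh
  component of a Jordan domain is the bulk**: honeycomb twin of
  `JordanDomain.exists_forall_mem_meshDomain_and_reachable` (transport of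
  `exists_hexBulk` for the scaled Jordan domain `D.map (mulLeft₀ R)⁻¹`).
* `exists_isEmbEndpointApprox` — every Dobrushin domain admits a honeycomb endpoint
  approximation `IsEmbEndpointApprox hexGraph hexCenter D a b` (diagonal stage selection as in
  `SAW.exists_isEndpointApprox`), and the route statement `hexEndpointApproxExists`.

Folklore (Duminil-Copin–Smirnov 2012 §4 take "the vertices of `Ω_δ` closest to `a`, `b`";
Lawler–Schramm–Werner 2004 §3.4). Anchors: `SimpleGraph.Iso.connectedComponentEquiv`,
`SimpleGraph.ConnectedComponent.isoEquivSupp`, `Homeomorph.mulLeft₀`, `JordanDomain.map`,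
`exists_stage_tendsto_atTop`, `embDomainGraph_adj_iff`.
-/

noncomputable section

open Set Metric MeasureTheory
open Literature.Probability.LatticeModels Literature.Probability.LatticeModels.TriMesh
open Literature.Probability.LatticeModels.HexMesh Literature.Probability.RandomPlanarGeometry

namespace Summit.CriticalPhenomena.SAWScalingLimit.Theorems.HexEndpointApprox

open Literature.Probability.RandomPlanarGeometry.SAW

/-! ### Dictionary: the honeycomb mesh graph of `Ω` is `G_N` of the scaled domain `{z | R z ∈ Ω}` -/

section Dict

variable {φ : HexVertex → Site 2}
  (hφ : ∀ v : HexVertex, φ v = ![2 * v.1 0 + v.1 1 + ((v.2.val : ℕ) : ℤ) + 1, v.1 1 - v.1 0])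
include hφ

/-- **Vertices.** `v` is a honeycomb mesh vertex of `Ω` iff its attached site is a triangular mesh
vertex of the scaled domain `S = {z | R z ∈ Ω}`, `R = (1 + ζ)/3`. [folklore] -/
theorem mem_embMeshVertices_iff_hexSite {Ω S : Set ℂ} (hS : S = {z : ℂ | (1 + triZeta) / 3 * z ∈ Ω})
    {δ : ℝ} {v : HexVertex} :
    v ∈ embMeshVertices hexCenter Ω δ ↔ φ v ∈ triMeshVertices S δ := by
  rw [mem_embMeshVertices_iff, mem_triMeshVertices_iff, hS, Set.mem_setOf_eq, smul_hexCenter_eq hφ]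

/-- **Honeycomb adjacency is `𝕋`-adjacency of the attached sites.** [folklore] -/
theorem hexGraph_adj_iff_hexSite {v w : HexVertex} : hexGraph.Adj v w ↔ triGraph.Adj (φ v) (φ w) := by
  refine ⟨triGraph_adj_hexSite hφ, fun h => ?_⟩
  obtain ⟨w', hw', hadj⟩ := exists_adj_of_triGraph_adj hφ h (not_three_dvd_hexSite hφ w)
  obtain rfl : w' = w := hexSite_injective hφ hw'
  exact hadj

omit hφ in
/-- Multiplication by a complex number carries segments to segments. [folklore] -/
theorem image_mul_segment (c a b : ℂ) :
    (fun z => c * z) '' segment ℝ a b = segment ℝ (c * a) (c * b) := by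
  have h := image_segment ℝ (LinearMap.mulLeft ℝ c).toAffineMap a b
  simp only [LinearMap.coe_toAffineMap, LinearMap.mulLeft_apply] at h
  exact h

omit hφ in
/-- The closure of the scaled domain is the scaled closure. [folklore] -/
theorem closure_setOf_mul_mem (Ω : Set ℂ) {c : ℂ} (hc : c ≠ 0) :
    closure {z : ℂ | c * z ∈ Ω} = {z : ℂ | c * z ∈ closure Ω} := by
  have h := (Homeomorph.mulLeft₀ c hc).preimage_closure Ω
  rw [Homeomorph.coe_mulLeft₀] at h
  exact h.symm

/-- **Edges.** Adjacency in the honeycomb mesh graph of `Ω` is adjacency of the attached sites in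
the triangular mesh graph of the scaled domain. [folklore] -/
theorem embMeshGraph_adj_iff_hexSite {Ω S : Set ℂ} (hS : S = {z : ℂ | (1 + triZeta) / 3 * z ∈ Ω})
    {δ : ℝ} {v w : HexVertex} :
    (embMeshGraph hexGraph hexCenter Ω δ).Adj v w ↔ (triMeshGraph S δ).Adj (φ v) (φ w) := by
  rw [embMeshGraph_adj_iff, triMeshGraph_adj_iff, hexGraph_adj_iff_hexSite hφ, smul_hexCenter_eq hφ,
    smul_hexCenter_eq hφ, ← image_mul_segment, Set.image_subset_iff, hS,
    closure_setOf_mul_mem Ω one_add_triZeta_div_three_ne_zero]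
  exact Iff.rfl

end Dict

/-! ### The largest honeycomb mesh component of a Jordan domain is the bulk -/

/-- **The largest honeycomb mesh component is the bulk (every Jordan domain).** For a Jordan
domain `D` and a compact `K ⊆ D.carrier`, for all sufficiently small mesh `δ > 0`:
* every honeycomb vertex whose mesh point `δ · hexCenter v` lies in `K` belongs to the discrete
  domain `embMeshDomain hexGraph hexCenter D.carrier δ` (the union of the connected components of
  maximal cardinality of the honeycomb mesh graph on the vertices with mesh point in `D.carrier`),
* which is a single connected component of that mesh graph.
Honeycomb twin of `JordanDomain.exists_forall_mem_meshDomain_and_reachable` /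
`…_triMeshDomain_and_reachable`: transport of `exists_hexBulk` for the scaled Jordan
domain `R⁻¹ D` along the graph isomorphism `v ↦ φ v` of `HexMeshCoord.lean`. [folklore] -/
theorem exists_forall_mem_hexMeshDomain_and_reachable (D : JordanDomain) {K : Set ℂ} (hK : IsCompact K) (hKΩ : K ⊆ D.carrier) :
    ∃ δ₀ > 0, ∀ δ : ℝ, 0 < δ → δ < δ₀ →
      (∀ v : HexVertex, (δ : ℂ) * hexCenter v ∈ K → v ∈ embMeshDomain hexGraph hexCenter D.carrier δ) ∧
      (∀ x ∈ embMeshDomain hexGraph hexCenter D.carrier δ,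
        ∀ y ∈ embMeshDomain hexGraph hexCenter D.carrier δ,
        ∃ (hx : x ∈ embMeshVertices hexCenter D.carrier δ)
          (hy : y ∈ embMeshVertices hexCenter D.carrier δ),
          (embMeshVertexGraph hexGraph hexCenter D.carrier δ).Reachable ⟨x, hx⟩ ⟨y, hy⟩) := by
  classical
  -- the attachment `φ`
  set φ : HexVertex → Site 2 := fun v =>
    ![2 * v.1 0 + v.1 1 + ((v.2.val : ℕ) : ℤ) + 1, v.1 1 - v.1 0] with hφ_def
  have hφ : ∀ v : HexVertex, φ v = ![2 * v.1 0 + v.1 1 + ((v.2.val : ℕ) : ℤ) + 1, v.1 1 - v.1 0] :=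
    fun v => rfl
  -- the scaled Jordan domain `R⁻¹ D`
  set c : ℂ := (1 + triZeta) / 3 with hc_def
  have hc : c ≠ 0 := one_add_triZeta_div_three_ne_zero
  set ψ : ℂ ≃ₜ ℂ := Homeomorph.mulLeft₀ c hc with hψ
  set D₁ : JordanDomain := D.map ψ.symm with hD₁
  have hcar : D₁.carrier = {z : ℂ | (1 + triZeta) / 3 * z ∈ D.carrier} := by
    show ψ.symm '' D.carrier = _
    rw [Homeomorph.image_symm, hψ, Homeomorph.coe_mulLeft₀]
    rfl
  -- the scaled compact
  set K₁ : Set ℂ := {z : ℂ | c * z ∈ K} with hK₁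
  have hK₁c : IsCompact K₁ := by
    have h := ψ.isCompact_preimage.2 hK
    rw [hψ, Homeomorph.coe_mulLeft₀] at h
    exact h
  have hK₁Ω : K₁ ⊆ D₁.carrier := by rw [hcar]; exact fun z hz => hKΩ hz
  obtain ⟨δ₀, hδ₀, hbulk⟩ := exists_hexBulk D₁ hK₁c hK₁Ω
  refine ⟨δ₀, hδ₀, fun δ hδ hδlt => ?_⟩
  set N : Set (Site 2) := {x : Site 2 | x ∈ triMeshVertices D₁.carrier δ ∧ ¬ (3 : ℤ) ∣ x 0 - x 1}
    with hN
  set H := embMeshVertexGraph hexGraph hexCenter D.carrier δ with hH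
  set G := (triMeshGraph D₁.carrier δ).induce N with hG
  obtain ⟨B, hBK, hBmax⟩ :
      ∃ B : G.ConnectedComponent, (∀ x : N, triMeshPoint δ (x : Site 2) ∈ K₁ → x ∈ B.supp) ∧
        ∀ C : G.ConnectedComponent, C ≠ B → C.supp.ncard < B.supp.ncard := hbulk δ hδ hδlt N hN
  -- the isomorphism `H ≃g G`
  have hmemN : ∀ v : embMeshVertices hexCenter D.carrier δ, φ v.1 ∈ N := fun v =>
    ⟨(mem_embMeshVertices_iff_hexSite hφ hcar).1 v.2, not_three_dvd_hexSite hφ _⟩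
  have hback : ∀ x : N, ∃ v : embMeshVertices hexCenter D.carrier δ, φ v.1 = x.1 := fun x => by
    obtain ⟨v, hv⟩ := exists_hexSite_eq hφ x.2.2
    refine ⟨⟨v, (mem_embMeshVertices_iff_hexSite hφ hcar).2 ?_⟩, hv⟩
    rw [hv]; exact x.2.1
  choose back hback using hback
  let e : H ≃g G :=
    { toFun := fun v => ⟨φ v.1, hmemN v⟩
      invFun := back
      left_inv := fun v => Subtype.ext (hexSite_injective hφ (hback _))
      right_inv := fun x => Subtype.ext (hback x)
      map_rel_iff' := by
        intro v w
        show (triMeshGraph D₁.carrier δ).Adj (φ v.1) (φ w.1) ↔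
          (embMeshGraph hexGraph hexCenter D.carrier δ).Adj v.1 w.1
        rw [embMeshGraph_adj_iff_hexSite hφ hcar] }
  -- corresponding components have the same number of vertices
  have hncard : ∀ C : H.ConnectedComponent,
      C.supp.ncard = (e.connectedComponentEquiv C).supp.ncard := fun C => by
    rw [← Nat.card_coe_set_eq, ← Nat.card_coe_set_eq]
    exact Nat.card_congr (SimpleGraph.ConnectedComponent.isoEquivSupp e C)
  set BH : H.ConnectedComponent := e.connectedComponentEquiv.symm B with hBH
  have hBHmax : ∀ C : H.ConnectedComponent, C ≠ BH → C.supp.ncard < BH.supp.ncard := by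
    intro C hC
    rw [hncard C, hncard BH, hBH, Equiv.apply_symm_apply]
    refine hBmax _ fun h => hC ?_
    rw [hBH, ← h, Equiv.symm_apply_apply]
  -- hence the discrete domain is the support of `BH`
  have hdom : embMeshDomain hexGraph hexCenter D.carrier δ = Subtype.val '' BH.supp := by
    ext x
    simp only [embMeshDomain, Set.mem_iUnion, Set.mem_image]
    constructor
    · rintro ⟨C, hCmax, y, hyC, rfl⟩
      have hCB : C = BH := by
        by_contra hCB
        exact (hBHmax C hCB).not_ge (hCmax BH)
      subst hCB
      exact ⟨y, hyC, rfl⟩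
    · rintro ⟨y, hyB, rfl⟩
      refine ⟨BH, fun C' => ?_, y, hyB, rfl⟩
      by_cases hC'B : C' = BH
      · rw [hC'B]
      · exact (hBHmax C' hC'B).le
  refine ⟨fun v hvK => ?_, fun x hx y hy => ?_⟩
  · -- vertices with mesh point in `K` lie in `BH`
    have hvΩ : v ∈ embMeshVertices hexCenter D.carrier δ := hKΩ hvK
    have hK1 : triMeshPoint δ (φ v) ∈ K₁ := by
      show c * triMeshPoint δ (φ v) ∈ K
      rw [hc_def, ← smul_hexCenter_eq hφ]; exact hvK
    have hB : G.connectedComponentMk (e ⟨v, hvΩ⟩) = B :=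
      (SimpleGraph.ConnectedComponent.mem_supp_iff _ _).1 (hBK (e ⟨v, hvΩ⟩) hK1)
    rw [hdom]
    refine ⟨⟨v, hvΩ⟩, ?_, rfl⟩
    rw [SimpleGraph.ConnectedComponent.mem_supp_iff, hBH, ← hB,
      SimpleGraph.Iso.connectedComponentEquiv_symm_apply, SimpleGraph.ConnectedComponent.map_mk]
    congr 1
    exact (e.symm_apply_apply _).symm
  · -- two points of the domain are joined
    rw [hdom] at hx hy
    obtain ⟨⟨x', hx'⟩, hxB, rfl⟩ := hx
    obtain ⟨⟨y', hy'⟩, hyB, rfl⟩ := hy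
    refine ⟨hx', hy', ?_⟩
    rw [SimpleGraph.ConnectedComponent.mem_supp_iff] at hxB hyB
    exact SimpleGraph.ConnectedComponent.exact (hxB.trans hyB.symm)

open Filter Topology

/-! ### Mesh paths inside the discrete domain `Ω_δ` (embedded graphs) -/

/-- `Ω_δ = embMeshDomain G emb Ω δ` is a union of connected components of the mesh graph on mesh
vertices: a mesh vertex adjacent to a vertex of `Ω_δ` belongs to `Ω_δ`. [folklore] -/
theorem mem_embMeshDomain_of_adj {V : Type*} {G : SimpleGraph V} {emb : V → ℂ} {Ω : Set ℂ} {δ : ℝ}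
    {u w : embMeshVertices emb Ω δ} (hu : (u : V) ∈ embMeshDomain G emb Ω δ)
    (h : (embMeshVertexGraph G emb Ω δ).Adj u w) : (w : V) ∈ embMeshDomain G emb Ω δ := by
  simp only [embMeshDomain, mem_iUnion, mem_image] at hu ⊢
  obtain ⟨C, hC, u', hu'C, hu'u⟩ := hu
  refine ⟨C, hC, w, ?_, rfl⟩
  have huu' : u' = u := Subtype.ext hu'u
  subst huu'
  rw [SimpleGraph.ConnectedComponent.mem_supp_iff] at hu'C ⊢
  rw [← hu'C]
  exact SimpleGraph.ConnectedComponent.sound h.symm.reachable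

/-- A walk of the mesh graph on mesh vertices that starts in `Ω_δ` is a walk of the graph
`Ω_δ = embDomainGraph G emb Ω δ`. [folklore] -/
theorem reachable_embDomainGraph_of_walk {V : Type*} {G : SimpleGraph V} {emb : V → ℂ} {Ω : Set ℂ}
    {δ : ℝ} {u w : embMeshVertices emb Ω δ} (p : (embMeshVertexGraph G emb Ω δ).Walk u w)
    (hu : (u : V) ∈ embMeshDomain G emb Ω δ) : (embDomainGraph G emb Ω δ).Reachable u w := by
  induction p with
  | nil => rfl
  | @cons u v w hadj p ih =>
    have hv : (v : V) ∈ embMeshDomain G emb Ω δ := mem_embMeshDomain_of_adj hu hadj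
    have hadj' : (embMeshGraph G emb Ω δ).Adj u v := by
      simpa only [SimpleGraph.comap_adj, Function.Embedding.subtype_apply] using hadj
    exact ((embDomainGraph_adj_iff G emb).2 ⟨hadj', hu, hv⟩).reachable.trans (ih hv)

/-! ### Honeycomb vertices near a point -/

/-- The shear has operator norm `≤ 2`: `‖T w‖ ≤ |re w| + |im w| ≤ 2 ‖w‖`. [folklore] -/
theorem norm_triLinear_le (w : ℂ) : ‖triLinear w‖ ≤ 2 * ‖w‖ := by
  have hζ : ‖triZeta‖ = 1 := by
    rw [triZeta, show (Real.pi * Complex.I / 3 : ℂ) = ((Real.pi / 3 : ℝ) : ℂ) * Complex.I by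
      push_cast; ring, Complex.norm_exp_ofReal_mul_I]
  rw [triLinear_apply]
  calc ‖(w.re : ℂ) + (w.im : ℂ) * triZeta‖ ≤ ‖(w.re : ℂ)‖ + ‖(w.im : ℂ) * triZeta‖ := norm_add_le _ _
    _ = |w.re| + |w.im| := by rw [norm_mul, hζ, mul_one, Complex.norm_real, Complex.norm_real,
        Real.norm_eq_abs, Real.norm_eq_abs]
    _ ≤ 2 * ‖w‖ := by linarith [Complex.abs_re_le_norm w, Complex.abs_im_le_norm w]

/-- **Every point of the plane is within distance `3` of a honeycomb vertex** (crude: the nearest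
triangular site through the shear, then the up face of its cell). [folklore] -/
theorem exists_hexVertex_dist_le (z : ℂ) : ∃ v : HexVertex, dist (hexCenter v) z ≤ 3 := by
  set u : ℂ := triLinear.symm z with hu
  set x : Site 2 := nearestSite 1 u with hx
  have hxu : dist (meshPoint 1 x) u ≤ 1 := dist_meshPoint_nearestSite_le one_pos u
  refine ⟨(x, 0), ?_⟩
  have hcen : hexCenter (x, (0 : Fin 2)) = triEmbed x + (1 + triZeta) / 3 := by
    simp only [hexCenter, Fin.val_zero, Nat.cast_zero, zero_add, one_mul]
  have htri : triEmbed x = triLinear (meshPoint 1 x) := by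
    rw [triLinear_meshPoint, triMeshPoint]; push_cast; ring
  have hz : z = triLinear u := by rw [hu, ContinuousLinearEquiv.apply_symm_apply]
  have hR : ‖(1 + triZeta) / 3‖ ≤ 1 := by
    have h := norm_one_add_triZeta_div_three_sq
    nlinarith [norm_nonneg ((1 + triZeta) / 3)]
  calc dist (hexCenter (x, 0)) z ≤ dist (hexCenter (x, 0)) (triEmbed x) + dist (triEmbed x) z :=
        dist_triangle _ _ _
    _ = ‖(1 + triZeta) / 3‖ + ‖triLinear (meshPoint 1 x - u)‖ := by
        rw [hcen, dist_eq_norm, add_sub_cancel_left, htri, hz, dist_eq_norm, ← map_sub]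
    _ ≤ 1 + 2 * ‖meshPoint 1 x - u‖ := add_le_add hR (norm_triLinear_le _)
    _ ≤ 3 := by rw [← dist_eq_norm]; linarith

/-- Scaled form: every point is within `3δ` of a vertex of the honeycomb lattice of mesh `δ > 0`.
[folklore] -/
theorem exists_hexVertex_dist_le_mul {δ : ℝ} (hδ : 0 < δ) (z : ℂ) :
    ∃ v : HexVertex, dist ((δ : ℂ) * hexCenter v) z ≤ 3 * δ := by
  obtain ⟨v, hv⟩ := exists_hexVertex_dist_le (z / δ)
  refine ⟨v, ?_⟩
  have hδ0 : (δ : ℂ) ≠ 0 := Complex.ofReal_ne_zero.2 hδ.ne'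
  have : z = (δ : ℂ) * (z / δ) := by field_simp
  rw [this, dist_eq_norm, ← mul_sub, norm_mul, Complex.norm_real, Real.norm_eq_abs, abs_of_pos hδ,
    ← dist_eq_norm]
  nlinarith

/-- If `N δ → ∞` as `δ → 0⁺`, `z n → p` at rate `1/(n+1)`, and `f δ` is within `3δ` of `z (N δ)`,
then `f δ → p` as `δ → 0⁺`. [folklore] -/
theorem tendsto_of_dist_le_of_tendsto {z : ℕ → ℂ} {p : ℂ} {N : ℝ → ℕ} {f : ℝ → ℂ}
    (hf : ∀ δ, 0 < δ → dist (f δ) (z (N δ)) ≤ 3 * δ)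
    (hz : ∀ n, dist (z n) p < 1 / ((n : ℝ) + 1)) (hN : Tendsto N (𝓝[>] (0 : ℝ)) atTop) :
    Tendsto f (𝓝[>] (0 : ℝ)) (𝓝 p) := by
  rw [Metric.tendsto_nhds]
  intro ε hε
  obtain ⟨n₀, hn₀⟩ := exists_nat_one_div_lt (half_pos hε)
  filter_upwards [Ioo_mem_nhdsGT (show 0 < ε / 6 by positivity),
    hN.eventually (eventually_ge_atTop n₀)] with δ hδ hNδ
  have h1 : dist (f δ) (z (N δ)) ≤ 3 * δ := hf δ hδ.1
  have h2 : dist (z (N δ)) p < ε / 2 := by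
    refine (hz (N δ)).trans_le ((one_div_le_one_div_of_le (by positivity) ?_).trans hn₀.le)
    have : (n₀ : ℝ) ≤ N δ := by exact_mod_cast hNδ
    linarith
  calc dist (f δ) p ≤ dist (f δ) (z (N δ)) + dist (z (N δ)) p := dist_triangle _ _ _
    _ < ε := by linarith [hδ.2]

/-! ### Every Dobrushin domain admits a honeycomb endpoint approximation -/

/-- **Honeycomb endpoint approximations exist** for every Dobrushin domain `D = (Ω; a, b)`: there
are honeycomb lattice endpoints `a_δ, b_δ`, joined in `Ω_δ ⊆ δℍ` for all small `δ > 0`, whose mesh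
points converge to `a` and `b`. Construction as for `δℤ²` (`SAW.exists_isEndpointApprox`):
interior points `z_n → a`, `w_n → b` with closed discs about them inside `Ω`; by
`exists_forall_mem_hexMeshDomain_and_reachable` (the largest honeycomb mesh
component of a Jordan domain is the bulk), for `δ` below a stage threshold honeycomb vertices
within `3δ` of `z_n`, `w_n` lie in `Ω_δ` and are joined there; a diagonal stage selection
`n = N(δ) → ∞` (`exists_stage_tendsto_atTop`) finishes. In particular the hypothesis
`∀ a b, IsEmbEndpointApprox hexGraph hexCenter D a b → …` of `HexSAWScalingLimit` is never
vacuous (Duminil-Copin–Smirnov: "`a_δ`, `b_δ` the vertices of `Ω_δ` closest to `a`, `b`").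
[folklore] -/
theorem exists_isEmbEndpointApprox (D : DobrushinDomain) :
    ∃ a b : ℝ → HexVertex, IsEmbEndpointApprox hexGraph hexCenter D a b := by
  classical
  -- interior points `z i n → D.pt i` with closed discs of radius `r i n` inside `Ω`
  have hz : ∀ (i : Fin 2) (n : ℕ), ∃ z ∈ D.carrier, dist z (D.pt i) < 1 / ((n : ℝ) + 1) ∧
      ∃ r > 0, closedBall z r ⊆ D.carrier := by
    intro i n
    obtain ⟨z, hz, hd⟩ := Metric.mem_closure_iff.1
      (frontier_subset_closure (D.pt_mem_frontier i)) (1 / ((n : ℝ) + 1)) (by positivity)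
    obtain ⟨r, hr, hsub⟩ := Metric.isOpen_iff.1 D.isOpen z hz
    exact ⟨z, hz, by rwa [dist_comm], r / 2, by positivity,
      (closedBall_subset_ball (by linarith)).trans hsub⟩
  choose z hzΩ hzd r hr hrΩ using hz
  -- stage `n`: both closed discs, a compact subset of `Ω`
  set K : ℕ → Set ℂ := fun n => closedBall (z 0 n) (r 0 n) ∪ closedBall (z 1 n) (r 1 n)
    with hK_def
  have hKc : ∀ n, IsCompact (K n) := fun n =>
    (isCompact_closedBall _ _).union (isCompact_closedBall _ _)
  have hKΩ : ∀ n, K n ⊆ D.carrier := fun n => union_subset (hrΩ 0 n) (hrΩ 1 n)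
  have hstage := fun n =>
    exists_forall_mem_hexMeshDomain_and_reachable D.toJordanDomain (hKc n) (hKΩ n)
  choose δ₀ hδ₀ hgood using hstage
  -- honeycomb vertices near the interior points
  have hnear : ∀ (δ : ℝ) (w : ℂ), ∃ v : HexVertex, 0 < δ → dist ((δ : ℂ) * hexCenter v) w ≤ 3 * δ := by
    intro δ w
    by_cases hδ : 0 < δ
    · obtain ⟨v, hv⟩ := exists_hexVertex_dist_le_mul hδ w
      exact ⟨v, fun _ => hv⟩
    · exact ⟨((0 : Site 2), 0), fun h => absurd h hδ⟩
  choose near hnear using hnear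
  -- diagonal stage selection
  have hr4 : ∀ i n, 0 < r i n / 4 := fun i n => by have := hr i n; positivity
  obtain ⟨N, hN, hNtop⟩ := exists_stage_tendsto_atTop
    (p := fun n δ => 0 < δ ∧ δ < min (δ₀ n) (min (r 0 n / 4) (r 1 n / 4)))
    (ε := fun n => min (δ₀ n) (min (r 0 n / 4) (r 1 n / 4)))
    (fun n => lt_min (hδ₀ n) (lt_min (hr4 0 n) (hr4 1 n))) (fun n δ h₁ h₂ => ⟨h₁, h₂⟩)
  refine ⟨fun δ => near δ (z 0 (N δ)), fun δ => near δ (z 1 (N δ)), ?_,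
    tendsto_of_dist_le_of_tendsto (fun δ hδ => hnear δ _ hδ) (hzd 0) hNtop,
    tendsto_of_dist_le_of_tendsto (fun δ hδ => hnear δ _ hδ) (hzd 1) hNtop⟩
  filter_upwards [hN] with δ ⟨hδ, hlt⟩
  have hδ₀' : δ < δ₀ (N δ) := hlt.trans_le (min_le_left _ _)
  have hr0 : δ < r 0 (N δ) / 4 := hlt.trans_le ((min_le_right _ _).trans (min_le_left _ _))
  have hr1 : δ < r 1 (N δ) / 4 := hlt.trans_le ((min_le_right _ _).trans (min_le_right _ _))
  have hmem : ∀ i : Fin 2, δ < r i (N δ) / 4 →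
      (δ : ℂ) * hexCenter (near δ (z i (N δ))) ∈ closedBall (z i (N δ)) (r i (N δ)) :=
    fun i hri => mem_closedBall.2 ((hnear δ _ hδ).trans (by linarith))
  obtain ⟨hin, hconn⟩ := hgood (N δ) δ hδ hδ₀'
  have ha := hin _ (Or.inl (hmem 0 hr0))
  have hb := hin _ (Or.inr (hmem 1 hr1))
  obtain ⟨_, _, ⟨q⟩⟩ := hconn _ ha _ hb
  exact reachable_embDomainGraph_of_walk q ha

/-- **Item `stmt-CriticalPhenomena-9864` (`HexEndpointApproxExists`, route `SAWMassiveIsingTilt`):**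
every Dobrushin domain that admits a `δℤ²` endpoint approximation admits a hexagonal one — in
fact every Dobrushin domain does (`exists_isEmbEndpointApprox`; the hypothesis is not needed).
[folklore] -/
theorem hexEndpointApproxExists :
    Summit.CriticalPhenomena.SAWScalingLimit.Theses.SAWMassiveIsingTilt.HexEndpointApproxExists := by
  intro D _ _ _
  exact exists_isEmbEndpointApprox D

end Summit.CriticalPhenomena.SAWScalingLimit.Theorems.HexEndpointApprox
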